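import Literature.Probability.LatticeModels.TorusFormFiniteRangeDecomposition
import Literature.Probability.LatticeModels.TorusMomentumSumBound
import Literature.LinearAlgebra.Matrix.FiniteRangeDecompositionMatrixBounds
import HarnessLib

/-!
# The finite-range decomposition on `(ℤ/L)² × ℤ/M`: the CLOSED-FORM kernel bound
# `|C_j(x,y)| ≤ (K/Θ)·(𝟙[j=1] + (L_*^j/2)²·(1/L + (π/4)√(Θ/c₀)/a_j)²·(1/M + (π/4)√(Θ/c₀)/a_j))`

Topic `Probability/LatticeModels`, namespace `Literature.Probability.LatticeModels`.  Assembly of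
`TorusFormFiniteRangeDecomposition.lean` (`torusFRD_abs_piece_le`: the entries of the pieces of a
general translation-invariant form `Q ⪰ c₀Δ` are bounded by momentum sums of any antitone majorant
of the scale function at `c₀ε(k,q)`), `FiniteRangeDecompositionMatrixBounds.lean`
(`exists_gFun_le_majorant`: the cubic majorant with one profile constant `K`) and
`TorusMomentumSumBound.lean` (`momentumSum_inv_cube_le`: `|Λ|⁻¹Σ(1+aε)^{-3} ≤ (1/L+π/(4√a))²(1/M+π/(4√a))`)
into the estimate a renormalisation-group step on the anisotropic space-time torus consumes
(BBS 2019, Proposition "Covariance decomposition" (3.11) `|C_{j;xy}| ≤ c L^{-(d-2)(j-1)}` for the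
Laplacian, `d = 3`; here for a GENERAL form, with the quasi-one-dimensional regime `a_j ≫ L√(c₀/Θ)`
of the elongated torus `M ≫ L` made explicit):

  for a real symmetric translation-invariant `Q` on `Λ = (ℤ/L)² × ℤ/M` with
  `c₀ Σ_{i=1}^{3} Σ_s (u_s − u_{s+e_i})² ≤ u·Qu` (`c₀ > 0`, `e_i` the unit steps), `Θ ≥ 3c₀`
  (so that `c₀ε ≤ 4Θ`), `L_* ≥ 2`, `j ≥ 1`, `a_j = L_*^{j-1}/2`:
  `|(MatrixFRD.piece Q Θ L_* j)_{xy}| ≤ (K/Θ)(𝟙[j=1] + (L_*^j/2)²(1/L + (π/4)√(Θ/c₀)/a_j)²(1/M + (π/4)√(Θ/c₀)/a_j))`.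

In the three-dimensional regime this is `≲ K′ Θ^{1/2} c₀^{-3/2} L_*^{3-j}` — the `L^{-(d-2)j}` decay.

## Contents (no new definition)

* `re_stChar_unitSteps_castSucc`, `re_stChar_unitSteps_last`, **`sum_unitSteps_dispersion`** —
  `Σ_i 2(1 − Re χ_{(k,q)}(e_i)) = Σ_{i<2} 2(1−cos(2πk_i/L)) + 2(1−cos(2πq/M))`;
* `dispersion_le_twelve`; **`torusFRD_abs_piece_le_explicit`** — the displayed bound.

## References

* R. Bauerschmidt, D. C. Brydges, G. Slade, LNM 2242 (2019), Ch. 3, Prop. "Covariance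
  decomposition" (3.11) and the `w`-lemma. [BauerschmidtBrydgesSlade2019RG]
* R. Bauerschmidt, PTRF 157 (2013), Thm. 1.2. [Bauerschmidt2013]
-/

noncomputable section

open Matrix Finset
open scoped ComplexConjugate Real MatrixOrder ComplexOrder
open Literature.LinearAlgebra.Matrix Literature.LinearAlgebra.Matrix.MatrixFRD

namespace Literature.Probability.LatticeModels

variable {L M : ℕ} [NeZero L] [NeZero M]

/-! ### The dispersion along the unit steps in explicit cosines -/

/-- A standard character at `q·1`: `Re e(q·1/M) = cos(2π q.val/M)`. [folklore] -/
theorem re_stdAddChar_mul_one (q : ZMod M) :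
    ((ZMod.stdAddChar (q * 1) : ℂ)).re = Real.cos (2 * π * (q.val : ℝ) / M) := by
  rw [stdAddChar_mul_eq_exp]
  have h : (2 * π * Complex.I * (((q.val * (1 : ZMod M).val : ℕ) : ℝ) : ℂ) / (M : ℂ)) =
      ((2 * π * ((q.val * (1 : ZMod M).val : ℕ) : ℝ) / M : ℝ) : ℂ) * Complex.I := by
    push_cast; ring
  rw [h, Complex.exp_ofReal_mul_I_re]
  -- `(1 : ZMod M).val = 1` unless `M = 1`, where both sides are `cos 0`-periodic values equal to `1`
  rcases Nat.lt_or_ge 1 M with hM | hM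
  · rw [ZMod.val_one'' hM.ne', mul_one]
  · have hM1 : M = 1 := le_antisymm hM (Nat.pos_of_ne_zero (NeZero.ne M))
    subst hM1
    have hq : q.val = 0 := by
      have := ZMod.val_lt q
      omega
    simp [hq]

/-- The spatial unit steps: `Re χ_{(k,q)}(e_i, 0) = cos(2π k_i.val/L)` (`i < 2`). [folklore] -/
theorem re_stChar_unitSteps_castSucc (kq : TorusSite 2 L × ZMod M) (i : Fin 2) :
    (stChar kq (unitSteps 2 L M i.castSucc)).re = Real.cos (2 * π * ((kq.1 i).val : ℝ) / L) := by
  rw [unitSteps_castSucc]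
  unfold stChar
  dsimp only
  rw [mul_zero, AddChar.map_zero_eq_one, mul_one, torusChar_re]
  congr 1
  rw [Finset.sum_eq_single i (fun j _ hj => by rw [Pi.single_eq_of_ne hj, ZMod.val_zero,
    Nat.cast_zero, mul_zero]) (fun h => absurd (Finset.mem_univ i) h), Pi.single_eq_same,
    latticeMomentum]
  rcases Nat.lt_or_ge 1 L with hL | hL
  · rw [ZMod.val_one'' hL.ne', Nat.cast_one, mul_one]
  · have hL1 : L = 1 := le_antisymm hL (Nat.pos_of_ne_zero (NeZero.ne L))
    subst hL1
    have hk : (kq.1 i).val = 0 := by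
      have := ZMod.val_lt (kq.1 i)
      omega
    simp [hk]

/-- The temporal unit step: `Re χ_{(k,q)}(0, 1) = cos(2π q.val/M)`. [folklore] -/
theorem re_stChar_unitSteps_last (kq : TorusSite 2 L × ZMod M) :
    (stChar kq (unitSteps 2 L M (Fin.last 2))).re = Real.cos (2 * π * ((kq.2).val : ℝ) / M) := by
  rw [unitSteps_last]
  unfold stChar
  dsimp only
  rw [torusChar_zero_right, one_mul]
  exact re_stdAddChar_mul_one kq.2

/-- **The dispersion along the three unit steps**:
`Σ_i 2(1 − Re χ_{(k,q)}(e_i)) = Σ_{i<2} 2(1 − cos(2πk_i/L)) + 2(1 − cos(2πq/M))`. [folklore] -/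
theorem sum_unitSteps_dispersion (kq : TorusSite 2 L × ZMod M) :
    ∑ i : Fin 3, 2 * (1 - (stChar kq (unitSteps 2 L M i)).re) =
      (∑ i : Fin 2, 2 * (1 - Real.cos (2 * π * ((kq.1 i).val : ℝ) / L))) +
        2 * (1 - Real.cos (2 * π * ((kq.2).val : ℝ) / M)) := by
  rw [Fin.sum_univ_castSucc]
  congr 1
  · refine Finset.sum_congr rfl fun i _ => ?_
    rw [re_stChar_unitSteps_castSucc]
  · rw [re_stChar_unitSteps_last]

omit [NeZero L] [NeZero M] in
/-- The dispersion is at most `12`. [folklore] -/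
theorem dispersion_le_twelve (kq : TorusSite 2 L × ZMod M) :
    (∑ i : Fin 2, 2 * (1 - Real.cos (2 * π * ((kq.1 i).val : ℝ) / L))) +
        2 * (1 - Real.cos (2 * π * ((kq.2).val : ℝ) / M)) ≤ 12 := by
  rw [Fin.sum_univ_two]
  nlinarith [Real.neg_one_le_cos (2 * π * ((kq.1 0).val : ℝ) / L),
    Real.neg_one_le_cos (2 * π * ((kq.1 1).val : ℝ) / L),
    Real.neg_one_le_cos (2 * π * ((kq.2).val : ℝ) / M)]

omit [NeZero L] [NeZero M] in
/-- The dispersion is nonnegative. [folklore] -/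
theorem dispersion_nonneg' (kq : TorusSite 2 L × ZMod M) :
    0 ≤ (∑ i : Fin 2, 2 * (1 - Real.cos (2 * π * ((kq.1 i).val : ℝ) / L))) +
        2 * (1 - Real.cos (2 * π * ((kq.2).val : ℝ) / M)) := by
  rw [Fin.sum_univ_two]
  nlinarith [Real.cos_le_one (2 * π * ((kq.1 0).val : ℝ) / L),
    Real.cos_le_one (2 * π * ((kq.1 1).val : ℝ) / L),
    Real.cos_le_one (2 * π * ((kq.2).val : ℝ) / M)]

/-! ### The closed-form kernel bound -/

/-- **THE CLOSED-FORM KERNEL BOUND for the finite-range decomposition of a general form on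
`(ℤ/L)² × ℤ/M`.**  There is `K > 0` (depending only on the profile) such that for every real
symmetric translation-invariant `Q` with `c₀ Σ_{i≤3}Σ_s(u_s − u_{s+e_i})² ≤ u·Qu` (`c₀ > 0`, `e_i`
the unit steps), every `Θ ≥ 3c₀`, `L_* ≥ 2`, `j ≥ 1` and all `x, y`:

  `|(C_j)_{xy}| ≤ (K/Θ)·(𝟙[j=1] + (L_*^j/2)²·(1/L + (π/4)√(Θ/c₀)/a_j)²·(1/M + (π/4)√(Θ/c₀)/a_j))`,
  `a_j = L_*^{j-1}/2`.

[cite: BauerschmidtBrydgesSlade2019RG, Ch. 3, Proposition "Covariance decomposition" (3.11)] -/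
theorem torusFRD_abs_piece_le_explicit :
    ∃ K : ℝ, 0 < K ∧ ∀ (L M : ℕ) [NeZero L] [NeZero M]
      (Q : Matrix (TorusSite 2 L × ZMod M) (TorusSite 2 L × ZMod M) ℝ) (c₀ Θ Lrg : ℝ),
      Q.IsHermitian → (∀ a x y, Q (x + a) (y + a) = Q x y) → 0 < c₀ →
      (∀ u, c₀ * ∑ i, ∑ s, (u s - u (s + unitSteps 2 L M i)) ^ 2 ≤ u ⬝ᵥ Q *ᵥ u) →
      3 * c₀ ≤ Θ → 2 ≤ Lrg → ∀ j : ℕ, 1 ≤ j → ∀ x y : TorusSite 2 L × ZMod M,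
      |piece Q Θ Lrg j x y| ≤ K / Θ * ((if j = 1 then (1:ℝ) else 0) +
        (Lrg ^ j / 2) ^ 2 * ((1 / L + π / 4 * Real.sqrt (Θ / c₀) / (Lrg ^ (j - 1) / 2)) ^ 2 *
          (1 / M + π / 4 * Real.sqrt (Θ / c₀) / (Lrg ^ (j - 1) / 2)))) := by
  obtain ⟨K, hK, hmaj⟩ := exists_gFun_le_majorant
  refine ⟨K, hK, ?_⟩
  intro L M _ _ Q c₀ Θ Lrg hQ hQt hc₀ hlow hΘ hLrg j hj x y
  have hΘ0 : 0 < Θ := by linarith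
  have hLrg0 : 0 ≤ Lrg := by linarith
  set a : ℝ := Lrg ^ (j - 1) / 2 with ha
  set b : ℝ := Lrg ^ j / 2 with hb
  have ha0 : 0 < a := by positivity
  -- the majorant and its antitonicity
  set G : ℝ → ℝ := fun μ => K / Θ * ((if j = 1 then (1:ℝ) else 0) +
      b ^ 2 * ((1 + a ^ 2 * (min μ (4 * Θ) / Θ)) ^ 3)⁻¹) with hG
  have hfg : ∀ μ, 0 ≤ μ → gFun Θ Lrg j μ ≤ G μ := fun μ hμ => hmaj Θ hΘ0 Lrg hLrg j hj μ hμ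
  have hGanti : AntitoneOn G (Set.Ici 0) := antitoneOn_gMajorant hK.le hΘ0 j
  -- the spectral bound
  have h1 := torusFRD_abs_piece_le hQ hQt (unitSteps 2 L M) hc₀.le hlow hΘ0 hLrg0 j hfg hGanti x y
  refine h1.trans ?_
  -- the momentum sum of the majorant, in explicit cosines and without the `min`
  have hc₀ε : ∀ kq : TorusSite 2 L × ZMod M,
      min (c₀ * ∑ i : Fin 3, 2 * (1 - (stChar kq (unitSteps 2 L M i)).re)) (4 * Θ) =
        c₀ * ((∑ i : Fin 2, 2 * (1 - Real.cos (2 * π * ((kq.1 i).val : ℝ) / L))) +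
          2 * (1 - Real.cos (2 * π * ((kq.2).val : ℝ) / M))) := by
    intro kq
    rw [sum_unitSteps_dispersion, min_eq_left]
    have := dispersion_le_twelve kq
    nlinarith
  set a' : ℝ := a ^ 2 * c₀ / Θ with ha'
  have ha'0 : 0 < a' := by positivity
  set T : TorusSite 2 L × ZMod M → ℝ := fun kq =>
    ((1 + a' * ((∑ i : Fin 2, 2 * (1 - Real.cos (2 * π * ((kq.1 i).val : ℝ) / L))) +
      2 * (1 - Real.cos (2 * π * ((kq.2).val : ℝ) / M)))) ^ 3)⁻¹ with hT
  have hterm : ∀ kq : TorusSite 2 L × ZMod M,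
      G (c₀ * ∑ i : Fin 3, 2 * (1 - (stChar kq (unitSteps 2 L M i)).re)) =
        K / Θ * (if j = 1 then (1:ℝ) else 0) + K / Θ * (b ^ 2 * T kq) := by
    intro kq
    simp only [hG, hT]
    rw [hc₀ε kq, ← mul_add]
    congr 3
    rw [ha']
    field_simp
  -- sum the constants and apply the momentum-sum bound
  have hN : (Fintype.card (TorusSite 2 L × ZMod M) : ℝ) = (L : ℝ) ^ 2 * M := by
    rw [card_spaceTime]; push_cast; ring
  have hL : (0 : ℝ) < L := by exact_mod_cast Nat.pos_of_ne_zero (NeZero.ne L)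
  have hM : (0 : ℝ) < M := by exact_mod_cast Nat.pos_of_ne_zero (NeZero.ne M)
  have hS : ∑ kq, T kq ≤ (1 + π * L / (4 * Real.sqrt a')) ^ 2 * (1 + π * M / (4 * Real.sqrt a')) :=
    momentumSum_inv_cube_le L M ha'0
  have hsumeq : ∑ kq : TorusSite 2 L × ZMod M, G (c₀ * ∑ i : Fin 3, 2 * (1 - (stChar kq (unitSteps 2 L M i)).re)) =
      ((L : ℝ) ^ 2 * M) * (K / Θ * (if j = 1 then (1:ℝ) else 0)) + K / Θ * (b ^ 2 * ∑ kq, T kq) := by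
    simp_rw [hterm]
    rw [Finset.sum_add_distrib, Finset.sum_const, Finset.card_univ, nsmul_eq_mul, hN, Finset.mul_sum,
      Finset.mul_sum]
  have hsq : Real.sqrt a' = a * Real.sqrt (c₀ / Θ) := by
    rw [ha', show a ^ 2 * c₀ / Θ = a ^ 2 * (c₀ / Θ) by ring, Real.sqrt_mul (sq_nonneg a),
      Real.sqrt_sq ha0.le]
  have hratio : π / (4 * Real.sqrt a') = π / 4 * Real.sqrt (Θ / c₀) / a := by
    rw [hsq]
    have hs : Real.sqrt (c₀ / Θ) ≠ 0 := (Real.sqrt_pos.mpr (by positivity)).ne'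
    have hinv : Real.sqrt (Θ / c₀) = (Real.sqrt (c₀ / Θ))⁻¹ := by
      rw [← Real.sqrt_inv, inv_div]
    rw [hinv]
    field_simp
  have hfac : ((L : ℝ) ^ 2 * M)⁻¹ * ((1 + π * L / (4 * Real.sqrt a')) ^ 2 *
      (1 + π * M / (4 * Real.sqrt a'))) =
      (1 / L + π / (4 * Real.sqrt a')) ^ 2 * (1 / M + π / (4 * Real.sqrt a')) := by
    field_simp
  rw [hN, hsumeq, ← hratio]
  calc ((L : ℝ) ^ 2 * M)⁻¹ * (((L : ℝ) ^ 2 * M) * (K / Θ * (if j = 1 then (1:ℝ) else 0)) +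
        K / Θ * (b ^ 2 * ∑ kq, T kq))
      = K / Θ * (if j = 1 then (1:ℝ) else 0) + K / Θ * (b ^ 2 * (((L : ℝ) ^ 2 * M)⁻¹ * ∑ kq, T kq)) := by
        field_simp
    _ ≤ K / Θ * (if j = 1 then (1:ℝ) else 0) + K / Θ * (b ^ 2 * (((L : ℝ) ^ 2 * M)⁻¹ *
        ((1 + π * L / (4 * Real.sqrt a')) ^ 2 * (1 + π * M / (4 * Real.sqrt a'))))) := by
        gcongr
    _ = K / Θ * ((if j = 1 then (1:ℝ) else 0) +
        b ^ 2 * ((1 / L + π / (4 * Real.sqrt a')) ^ 2 * (1 / M + π / (4 * Real.sqrt a')))) := by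
        rw [hfac]; ring

end Literature.Probability.LatticeModels

end
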